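import Summits.Ventures.PercRepro.ProfilePointedMinimalWitness
import Summits.Ventures.PercRepro.ProfilePointedUniform
import Summits.Ventures.PercRepro.ProfilePointedSplit

/-!
# PercRepro — (Ĉ) AT A LEVEL WHOSE SUCCESSOR LEVEL IS FULL, HENCE ON EVERY PAVING MATROID — UNCONDITIONAL
(p10, gen 25)

For a finite matroid `M` on `N = #E` elements, a point `p` and a level `k` with `2k + 2 ≤ N`, the pointed
conjecture (Ĉ) (`PointedRow`, gen 13) reads `(N − k − 1)·P_k ≤ k·P_{k+1} + (N − 2k − 1)·c^p_k`.  Every instance of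
(Ĉ) in the tree so far is conditional on the named fact `BiIndepDensityLogConcave` (Theorem A, Brändén–Huh) — except
the loop case.  THIS FILE proves (Ĉ) UNCONDITIONALLY in a regime that contains every paving matroid:

* `pointedRow_level_of_full_succ` — **if every `(k+1)`-subset of `E` is bi-independent, (Ĉ) holds at `(M, p, k)` for
  every point `p`.**  Proof: then every `p`-avoiding bi-independent `k`-set extends by `p`, so `c^p_k = out_k =
  P_k − in_k` (`extCount_eq_outCount_of_full_succ`) and (Ĉ) becomes `k·P_k + (N − 2k − 1)·in_k ≤ k·P_{k+1}`; with
  `P_{k+1} = C(N, k+1)` (`biIndepSets_eq_powersetCard_of_full`), `P_k ≤ C(N, k)` (`card_biIndepSets_le_choose`) and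
  `in_k ≤ C(N − 1, k − 1)` (`inCount_le_choose`, the injection `X ↦ X ∖ p`) this is the binomial inequality
  `k·C(N,k) + (N − 2k − 1)·C(N − 1, k − 1) ≤ k·C(N, k+1)` (`choose_mul_ineq`, slack `k·C(N,k)·(N−2k−1)(N−k−1)/(N(k+1))`).
* `pointedRow_level_of_girth` — the regime in girth terms: every set with fewer than `g` elements independent,
  `k + 2 ≤ g` and `N ≤ k + g`.
* `IsPaving` (every set with fewer than `ρ(E)` elements is independent — the paving matroids, conjecturally almost all
  matroids), `pointedRowAt_of_paving` — **(Ĉ) AT EVERY LEVEL OF EVERY POINT OF EVERY PAVING MATROID, UNCONDITIONALLY**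
  (below the level `N − ρ` the profile vanishes, `biIndepSets_eq_empty_of_lt`; from `N − ρ` on, the window `2k+2 ≤ N`
  forces `k + 2 ≤ ρ` and every `(k+1)`-subset is bi-independent), and `MinimalWitness.not_paving`: a minimal
  (Ĉ)-witness is NOT paving — it has a dependent set with fewer than `ρ(E)` elements (`MinimalWitness.exists_dependent`).
* `isPaving_of_rankBySize`, `pointedRowAt_of_rankBySize'` — the uniform matroids are paving, so gen 23's uniform
  instance (`pointedRowAt_of_rankBySize`, conditional) holds UNCONDITIONALLY.

Nothing here asserts (Ĉ) in general.
-/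

open scoped Matroid

namespace PercRepro.Cogirth

open Finset ThmH Skew

variable {α : Type} [DecidableEq α] {M : Matroid α} [M.Finite]

/-! ### The binomial inequality -/

/-- `k·C(N,k) + m·C(N−1,k−1) ≤ k·C(N,k+1)` for `N = 2k + 1 + m`, `k ≥ 1` (no subtraction form). -/
theorem choose_mul_ineq_aux (j m : ℕ) :
    (j + 1) * (2 * j + 3 + m).choose (j + 1) + m * (2 * j + 2 + m).choose j ≤
      (j + 1) * (2 * j + 3 + m).choose (j + 2) := by
  have hD := Nat.add_one_mul_choose_eq (2 * j + 2 + m) j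
  have hE := Nat.choose_succ_right_eq (2 * j + 3 + m) (j + 1)
  rw [show 2 * j + 2 + m + 1 = 2 * j + 3 + m by omega] at hD
  rw [show 2 * j + 3 + m - (j + 1) = j + 2 + m by omega, show j + 1 + 1 = j + 2 by omega] at hE
  have hpos : 0 < (2 * j + 3 + m) * (j + 2) := by positivity
  refine Nat.le_of_mul_le_mul_left ?_ hpos
  have harith : (2 * j + 3 + m) * (j + 2) + (j + 2) * m ≤ (2 * j + 3 + m) * (j + 2 + m) := by
    nlinarith [Nat.zero_le j, Nat.zero_le m]
  calc (2 * j + 3 + m) * (j + 2) * ((j + 1) * (2 * j + 3 + m).choose (j + 1) + m * (2 * j + 2 + m).choose j)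
      = (2 * j + 3 + m) * (j + 2) * (j + 1) * (2 * j + 3 + m).choose (j + 1) +
          (j + 2) * m * ((2 * j + 3 + m) * (2 * j + 2 + m).choose j) := by ring
    _ = (2 * j + 3 + m) * (j + 2) * (j + 1) * (2 * j + 3 + m).choose (j + 1) +
          (j + 2) * m * ((2 * j + 3 + m).choose (j + 1) * (j + 1)) := by rw [hD]
    _ = (2 * j + 3 + m).choose (j + 1) * (j + 1) * ((2 * j + 3 + m) * (j + 2) + (j + 2) * m) := by ring
    _ ≤ (2 * j + 3 + m).choose (j + 1) * (j + 1) * ((2 * j + 3 + m) * (j + 2 + m)) :=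
        Nat.mul_le_mul_left _ harith
    _ = (2 * j + 3 + m) * (j + 1) * ((2 * j + 3 + m).choose (j + 1) * (j + 2 + m)) := by ring
    _ = (2 * j + 3 + m) * (j + 1) * ((2 * j + 3 + m).choose (j + 2) * (j + 2)) := by rw [hE]
    _ = (2 * j + 3 + m) * (j + 2) * ((j + 1) * (2 * j + 3 + m).choose (j + 2)) := by ring

/-- **The binomial inequality**: `k·C(N,k) + (N − 2k − 1)·C(N − 1, k − 1) ≤ k·C(N, k+1)` for `1 ≤ k`, `2k + 1 ≤ N`. -/
theorem choose_mul_ineq (N k : ℕ) (hk : 1 ≤ k) (hN : 2 * k + 1 ≤ N) :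
    k * N.choose k + (N - 2 * k - 1) * (N - 1).choose (k - 1) ≤ k * N.choose (k + 1) := by
  obtain ⟨j, rfl⟩ : ∃ j, k = j + 1 := ⟨k - 1, by omega⟩
  obtain ⟨m, rfl⟩ : ∃ m, N = 2 * j + 3 + m := ⟨N - (2 * j + 3), by omega⟩
  have := choose_mul_ineq_aux j m
  rw [show 2 * j + 3 + m - 2 * (j + 1) - 1 = m by omega, show 2 * j + 3 + m - 1 = 2 * j + 2 + m by omega,
    show j + 1 - 1 = j by omega, show j + 1 + 1 = j + 2 by omega]
  exact this

/-! ### The level whose successor is full -/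

/-- If every `(k+1)`-subset of `E` is bi-independent, every `p`-avoiding bi-independent `k`-set extends by `p`:
`c^p_k = out_k`. -/
theorem extCount_eq_outCount_of_full_succ {k : ℕ} {p : α} (hp : p ∈ gr M)
    (hfull : ∀ X ⊆ gr M, X.card = k + 1 → X ∈ biIndepSets M (k + 1)) :
    extCount M k p = outCount M k p := by
  unfold extCount outCount
  congr 1
  apply filter_congr
  intro X hX
  constructor
  · exact fun h => h.1
  · intro hpX
    refine ⟨hpX, hfull _ ?_ ?_⟩
    · exact insert_subset hp (mem_biIndepSets.1 hX).1
    · rw [card_insert_of_notMem hpX, (mem_biIndepSets.1 hX).2.1]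

/-- If every `k`-subset of `E` is bi-independent, the bi-independent `k`-sets are all the `k`-subsets. -/
theorem biIndepSets_eq_powersetCard_of_full {k : ℕ}
    (hfull : ∀ X ⊆ gr M, X.card = k → X ∈ biIndepSets M k) :
    biIndepSets M k = (gr M).powersetCard k := by
  ext X
  rw [mem_powersetCard]
  constructor
  · intro h
    exact ⟨(mem_biIndepSets.1 h).1, (mem_biIndepSets.1 h).2.1⟩
  · rintro ⟨h1, h2⟩
    exact hfull X h1 h2

/-- The bi-independent `k`-sets are `k`-subsets of the ground set. -/
theorem biIndepSets_subset_powersetCard (M : Matroid α) [M.Finite] (k : ℕ) :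
    biIndepSets M k ⊆ (gr M).powersetCard k := by
  intro X hX
  rw [mem_powersetCard]
  exact ⟨(mem_biIndepSets.1 hX).1, (mem_biIndepSets.1 hX).2.1⟩

/-- `P_k ≤ C(N, k)`. -/
theorem card_biIndepSets_le_choose (M : Matroid α) [M.Finite] (k : ℕ) :
    (biIndepSets M k).card ≤ (gr M).card.choose k := by
  have := card_le_card (biIndepSets_subset_powersetCard M k)
  rwa [card_powersetCard] at this

/-- `in_k ≤ C(N − 1, k − 1)`: the bi-independent `k`-sets through `p` inject into the `(k−1)`-subsets of `E ∖ p`. -/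
theorem inCount_le_choose {k : ℕ} {p : α} (hp : p ∈ gr M) :
    inCount M k p ≤ ((gr M).card - 1).choose (k - 1) := by
  unfold inCount
  have h := card_le_card_of_injOn (fun X : Finset α => X.erase p)
    (s := (biIndepSets M k).filter (fun X => p ∈ X)) (t := ((gr M).erase p).powersetCard (k - 1)) ?_ ?_
  · rwa [card_powersetCard, card_erase_of_mem hp] at h
  · intro X hX
    simp only [coe_filter, Set.mem_setOf_eq] at hX
    obtain ⟨hX, hpX⟩ := hX
    rw [mem_coe, mem_powersetCard]
    refine ⟨erase_subset_erase p (mem_biIndepSets.1 hX).1, ?_⟩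
    rw [card_erase_of_mem hpX, (mem_biIndepSets.1 hX).2.1]
  · intro X hX Y hY hXY
    simp only [coe_filter, Set.mem_setOf_eq] at hX hY
    have := congrArg (insert p) hXY
    simp only at this
    rwa [insert_erase hX.2, insert_erase hY.2] at this

/-- **(Ĉ) AT A LEVEL WHOSE SUCCESSOR LEVEL IS FULL** (UNCONDITIONAL): if every `(k+1)`-subset of `E` is
bi-independent and `2k + 2 ≤ N`, then `(N − k − 1)·P_k ≤ k·P_{k+1} + (N − 2k − 1)·c^p_k` for every point `p`. -/
theorem pointedRow_level_of_full_succ {k : ℕ} (hk : 2 * k + 2 ≤ (gr M).card) {p : α} (hp : p ∈ gr M)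
    (hfull : ∀ X ⊆ gr M, X.card = k + 1 → X ∈ biIndepSets M (k + 1)) :
    ((gr M).card - k - 1) * (biIndepSets M k).card ≤
      k * (biIndepSets M (k + 1)).card + ((gr M).card - 2 * k - 1) * extCount M k p := by
  have hc := extCount_eq_outCount_of_full_succ hp hfull
  have hP1 : (biIndepSets M (k + 1)).card = (gr M).card.choose (k + 1) := by
    rw [biIndepSets_eq_powersetCard_of_full hfull, card_powersetCard]
  have hPk := card_biIndepSets_le_choose M k
  have hio := inCount_add_outCount M k p
  rw [hc, ← hio, hP1]
  rw [← hio] at hPk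
  rcases Nat.eq_zero_or_pos k with rfl | hkpos
  · rw [inCount_zero]
    simp
  · have hin := inCount_le_choose (M := M) (k := k) hp
    have hb := choose_mul_ineq (gr M).card k hkpos (by omega)
    have hsplit : (gr M).card - k - 1 = ((gr M).card - 2 * k - 1) + k := by omega
    rw [hsplit, add_mul]
    have h1 := Nat.mul_le_mul_left ((gr M).card - 2 * k - 1) hin
    have h2 := Nat.mul_le_mul_left k hPk
    nlinarith [h1, h2, hb]

/-- **THE GIRTH FORM**: if every subset of `E` with fewer than `g` elements is independent, `2k + 2 ≤ N`, `k + 2 ≤ g`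
and `N ≤ k + g`, then (Ĉ) holds at `(M, p, k)` for every point `p` (every `(k+1)`-set and its complement are
independent). -/
theorem pointedRow_level_of_girth {g k : ℕ} (hg : ∀ X ⊆ gr M, X.card < g → rk M X = X.card)
    (hk : 2 * k + 2 ≤ (gr M).card) (hk1 : k + 2 ≤ g) (hk2 : (gr M).card ≤ k + g) {p : α} (hp : p ∈ gr M) :
    ((gr M).card - k - 1) * (biIndepSets M k).card ≤
      k * (biIndepSets M (k + 1)).card + ((gr M).card - 2 * k - 1) * extCount M k p := by
  apply pointedRow_level_of_full_succ hk hp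
  intro X hX hXc
  rw [mem_biIndepSets]
  refine ⟨hX, hXc, hg X hX (by omega), hg _ sdiff_subset ?_⟩
  rw [card_sdiff_of_subset hX, hXc]
  omega

/-! ### Paving matroids -/

omit [DecidableEq α] in
/-- **A paving matroid**: every subset of the ground set with fewer than `ρ(E)` elements is independent. -/
def IsPaving (M : Matroid α) [M.Finite] : Prop :=
  ∀ X ⊆ gr M, X.card + 1 ≤ rk M (gr M) → rk M X = X.card

/-- **(Ĉ) AT EVERY LEVEL OF EVERY POINT OF EVERY PAVING MATROID** (UNCONDITIONAL): below `N − ρ` the profile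
vanishes; from `N − ρ` on, inside the window, every `(k+1)`-subset is bi-independent. -/
theorem pointedRowAt_of_paving (hpav : IsPaving M) {p : α} (hp : p ∈ gr M) : PointedRowAt M p := by
  intro k hk
  by_cases hlt : k + rk M (gr M) < (gr M).card
  · rw [biIndepSets_eq_empty_of_lt hlt, card_empty, mul_zero]
    exact Nat.zero_le _
  · have hlt' := not_lt.1 hlt
    exact pointedRow_level_of_girth (g := rk M (gr M)) (fun X hX hXc => hpav X hX hXc) hk (by omega) hlt' hp

/-- **A MINIMAL (Ĉ)-WITNESS IS NOT PAVING** (unconditional). -/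
theorem MinimalWitness.not_paving {p : α} (h : MinimalWitness M p) : ¬ IsPaving M :=
  fun hpav => h.2.1 (pointedRowAt_of_paving hpav h.1)

/-- **A MINIMAL (Ĉ)-WITNESS HAS A DEPENDENT SET WITH FEWER THAN `ρ(E)` ELEMENTS** (unconditional): with gen 24's
`MinimalWitness.rk_eq_three_of_card_three` (every `3`-subset independent) such a set has at least `4` elements, so
`ρ(E) ≥ 5`. -/
theorem MinimalWitness.exists_dependent {p : α} (h : MinimalWitness M p) :
    ∃ X ⊆ gr M, X.card + 1 ≤ rk M (gr M) ∧ rk M X < X.card := by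
  by_contra hcon
  exact h.not_paving (fun X hX hXc =>
    le_antisymm (rk_le_card X) (not_lt.1 (fun hlt => hcon ⟨X, hX, hXc, hlt⟩)))

omit [DecidableEq α] in
/-- The uniform matroids (rank by size) are paving: a set with fewer than `ρ(E)` elements has the rank of an
equally large subset of a basis. -/
theorem isPaving_of_rankBySize (h : RankBySize M) : IsPaving M := by
  intro X hX hXc
  obtain ⟨B, hBg, hBc, hBi⟩ := exists_basis_finset (M := M)
  obtain ⟨Y, hYB, hYc⟩ := exists_subset_card_eq (s := B) (n := X.card) (by omega)
  have hY : rk M Y = Y.card :=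
    rk_eq_card_of_subset_of_rk_eq_card hYB (rk_eq_card_of_indep' hBi)
  rw [h X Y hX (hYB.trans hBg) hYc.symm, hY, hYc]

/-- **(Ĉ) AT EVERY LEVEL OF EVERY POINT OF EVERY UNIFORM MATROID, UNCONDITIONALLY** (gen 23's
`pointedRowAt_of_rankBySize` without the named fact). -/
theorem pointedRowAt_of_rankBySize' (h : RankBySize M) {p : α} (hp : p ∈ gr M) : PointedRowAt M p :=
  pointedRowAt_of_paving (isPaving_of_rankBySize h) hp

end PercRepro.Cogirth
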